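import Mathlib
import Summits.ValiantsHypothesis.ValiantsHypothesis.Theorems.NewtonUnitEquationsDissociatedUniformShadowVertices

/-!
# Crux `NewtonUnitEquations.DissociatedUniform` (stmt-ValiantsHypothesis-5905), line `greedy-basis-shadow`:
# on LABELLED frames the shadow is the union of the class-hull vertex words (the design stratum of the kernel)

Companion to `…DissociatedUniformShadowVertices` (`fshadow_eq_pencilVertexWords`: on a dissociated frame the frame shadow of
Theorem Q is the set of words exposed as a Newton-polygon vertex of some member of the coefficient pencil
`∑ i, C (φ i) * ∏ j, f i j`).

A frame is LABELLED by `Λ : (words) → Y` with column table `v : Y → ℂ^k` if its Khatri–Rao columns factor through the label,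
`col f a = v (Λ a)` on the box, and the realised column values are pairwise "separated": `v (Λ a)` is not in the span of the
other values `v y`, `y ≠ Λ a`.  Every abelian character design is labelled (label = the class `∑ j g_j (a j)` in the group,
`v` = the character table, separated because characters are linearly independent); so are integer-weight designs with enough
products and the CNF couplings of the disprover's census (Cruxes/DissociatedUniform/Disproof.lean, notes N1/N6).

* `ShadowVerticesDesign.fshadow_eq_classVertexWords`: on a labelled dissociated frame, a word is in the frame shadow iff its
  point is a vertex of the convex hull of the points of ITS OWN LABEL CLASS.  (⊆: the pencil member exposing the word has the
  whole class in its support, and extreme points of a hull stay extreme in the hull of a subset containing them; ⊇: a functional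
  separating `v (Λ a)` from the other column values gives a pencil member whose support is exactly the class.)
* `ShadowVerticesDesign.classVertexWords_le_of_smallShadow`: hence the registered kernel stub `stub_smallShadow` (its signature
  verbatim as hypothesis) implies the CLASS-HULL VERTEX BOUND on small labelled frames: on every labelled dissociated
  `k`-product frame with `n ≤ 4k²` coordinates and `≤ 4k² + 1` letters per coordinate, the words whose point is a vertex of
  the hull of their label class number at most `(k + 2)^P` — Conjecture K of the line notes (class hulls of abelian designs)
  restricted to small frames is therefore a NECESSARY condition for the kernel, stated here in the tree's vocabulary so that
  a design family violating it refutes `stub_smallShadow` (and, each class being the support of one pencil member, the crux).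
[folklore: exposed points; linear independence of characters]
-/

set_option linter.dupNamespace false

open scoped BigOperators
open MvPolynomial

namespace Summit.ValiantsHypothesis.ValiantsHypothesis.Theorems.NewtonUnitEquationsDissociatedUniform

namespace ShadowVerticesDesign

open QuasiPoly ShadowVertices

variable {k m : ℕ} {Y : Type}

/-- On a labelled dissociated frame, the coefficient of a pencil member at the point of a word of the box only depends on
the label of the word. -/
theorem coeff_pencil_eq_of_label (A : Fin m → Finset (Fin 2 →₀ ℕ)) (f : Fin k → Fin m → MvPolynomial (Fin 2) ℂ)
    (hsupp : ∀ i j, (f i j).support ⊆ A j)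
    (hdis : ∀ a b : Fin m → (Fin 2 →₀ ℕ), (∀ j, a j ∈ A j) → (∀ j, b j ∈ A j) → ∑ j, a j = ∑ j, b j → a = b)
    (Λ : (Fin m → (Fin 2 →₀ ℕ)) → Y) (v : Y → Fin k → ℂ)
    (hcol : ∀ a ∈ Fintype.piFinset A, col f a = v (Λ a)) (φ : Fin k → ℂ)
    {a : Fin m → (Fin 2 →₀ ℕ)} (ha : a ∈ Fintype.piFinset A) :
    coeff (∑ j, a j) (∑ i, C (φ i) * ∏ j, f i j) = ∑ i, φ i * v (Λ a) i := by
  rw [coeff_pencil A f hsupp hdis φ a (Fintype.mem_piFinset.mp ha), hcol a ha]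

/-- **The design dictionary.**  On a labelled dissociated frame (columns factor through the label `Λ` via a separated
column table `v`), a word of the box lies in the frame shadow iff its point is a vertex of the convex hull of the points of
its own label class. [folklore] -/
theorem fshadow_eq_classVertexWords (A : Fin m → Finset (Fin 2 →₀ ℕ)) (f : Fin k → Fin m → MvPolynomial (Fin 2) ℂ)
    (hsupp : ∀ i j, (f i j).support ⊆ A j)
    (hdis : ∀ a b : Fin m → (Fin 2 →₀ ℕ), (∀ j, a j ∈ A j) → (∀ j, b j ∈ A j) → ∑ j, a j = ∑ j, b j → a = b)
    (Λ : (Fin m → (Fin 2 →₀ ℕ)) → Y) (v : Y → Fin k → ℂ)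
    (hcol : ∀ a ∈ Fintype.piFinset A, col f a = v (Λ a))
    (hsep : ∀ a ∈ Fintype.piFinset A, v (Λ a) ∉ Submodule.span ℂ (v '' {y : Y | y ≠ Λ a})) :
    fshadow A f = {a : Fin m → (Fin 2 →₀ ℕ) | a ∈ Fintype.piFinset A ∧
      (fun e : Fin 2 →₀ ℕ => fun i : Fin 2 => ((e i : ℕ) : ℝ)) (∑ j, a j) ∈
        Set.extremePoints ℝ (convexHull ℝ ((fun e : Fin 2 →₀ ℕ => fun i : Fin 2 => ((e i : ℕ) : ℝ)) ''
          ((fun b : Fin m → (Fin 2 →₀ ℕ) => ∑ j, b j) ''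
            {b : Fin m → (Fin 2 →₀ ℕ) | b ∈ Fintype.piFinset A ∧ Λ b = Λ a})))} := by
  classical
  rw [fshadow_eq_pencilVertexWords A f hsupp hdis]
  ext a
  simp only [Set.mem_setOf_eq]
  constructor
  · rintro ⟨haE, φ, hv⟩
    refine ⟨haE, ?_⟩
    -- the point of `a` is in the support, so its coefficient is nonzero; the whole class has the same coefficient
    have hmem : (fun e : Fin 2 →₀ ℕ => fun i : Fin 2 => ((e i : ℕ) : ℝ)) (∑ j, a j) ∈
        (fun e : Fin 2 →₀ ℕ => fun i : Fin 2 => ((e i : ℕ) : ℝ)) ''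
          ((∑ i, C (φ i) * ∏ j, f i j).support : Set (Fin 2 →₀ ℕ)) := extremePoints_convexHull_subset hv
    obtain ⟨e, he, hea⟩ := hmem
    have hea' : e = ∑ j, a j := by
      ext i
      have h := congr_fun hea i
      dsimp only at h
      exact_mod_cast h
    subst hea'
    have hne : ∑ i, φ i * v (Λ a) i ≠ 0 := by
      rw [← coeff_pencil_eq_of_label A f hsupp hdis Λ v hcol φ haE]
      exact mem_support_iff.mp (Finset.mem_coe.mp he)
    -- the class lies in the support; extreme points of the larger hull inside the class stay extreme
    -- (cf. `OfKLetterFrame.mem_extremePoints_convexHull_mono`, not imported to stay off the route cone)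
    have hsub : (fun b : Fin m → (Fin 2 →₀ ℕ) => ∑ j, b j) ''
          {b : Fin m → (Fin 2 →₀ ℕ) | b ∈ Fintype.piFinset A ∧ Λ b = Λ a} ⊆
        ((∑ i, C (φ i) * ∏ j, f i j).support : Set (Fin 2 →₀ ℕ)) := by
      rintro _ ⟨b, ⟨hbE, hba⟩, rfl⟩
      rw [Finset.mem_coe, mem_support_iff, coeff_pencil_eq_of_label A f hsupp hdis Λ v hcol φ hbE, hba]
      exact hne
    have hST := Set.image_mono (f := fun e : Fin 2 →₀ ℕ => fun i : Fin 2 => ((e i : ℕ) : ℝ)) hsub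
    rw [mem_extremePoints] at hv ⊢
    refine ⟨subset_convexHull ℝ _ ⟨∑ j, a j, ⟨a, ⟨haE, rfl⟩, rfl⟩, rfl⟩, fun x₁ hx₁ x₂ hx₂ hx => ?_⟩
    exact hv.2 x₁ (convexHull_mono hST hx₁) x₂ (convexHull_mono hST hx₂) hx
  · rintro ⟨haE, hv⟩
    refine ⟨haE, ?_⟩
    -- a functional separating `v (Λ a)` from the other column values
    obtain ⟨L, hLa, hLspan⟩ := Submodule.exists_dual_map_eq_bot_of_notMem (hsep a haE) inferInstance
    set φ : Fin k → ℂ := fun i => L (fun j => if i = j then (1 : ℂ) else 0) with hφ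
    have hLφ : ∀ y : Fin k → ℂ, ∑ i, φ i * y i = L y := by
      intro y
      rw [LinearMap.pi_apply_eq_sum_univ L y]
      refine Finset.sum_congr rfl fun i _ => ?_
      rw [hφ, smul_eq_mul, mul_comm]
    have hzero : ∀ y : Y, y ≠ Λ a → L (v y) = 0 := by
      intro y hy
      have hmem : v y ∈ Submodule.span ℂ (v '' {y' : Y | y' ≠ Λ a}) := Submodule.subset_span ⟨y, hy, rfl⟩
      have : L (v y) ∈ (Submodule.span ℂ (v '' {y' : Y | y' ≠ Λ a})).map L := Submodule.mem_map_of_mem hmem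
      rw [hLspan] at this
      exact (Submodule.mem_bot ℂ).mp this
    refine ⟨φ, ?_⟩
    -- the support of this pencil member is exactly the class of `a`
    have hsuppeq : (((∑ i, C (φ i) * ∏ j, f i j).support : Finset (Fin 2 →₀ ℕ)) : Set (Fin 2 →₀ ℕ)) =
        (fun b : Fin m → (Fin 2 →₀ ℕ) => ∑ j, b j) ''
          {b : Fin m → (Fin 2 →₀ ℕ) | b ∈ Fintype.piFinset A ∧ Λ b = Λ a} := by
      ext e
      constructor
      · intro he
        have he' := Finset.mem_coe.mp he
        obtain ⟨b, hbE, rfl⟩ := Finset.mem_image.mp (support_pencil_subset A f hsupp φ he')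
        refine ⟨b, ⟨hbE, ?_⟩, rfl⟩
        by_contra hne
        have h0 : coeff (∑ j, b j) (∑ i, C (φ i) * ∏ j, f i j) = 0 := by
          rw [coeff_pencil_eq_of_label A f hsupp hdis Λ v hcol φ hbE, hLφ, hzero _ hne]
        exact (mem_support_iff.mp he') h0
      · rintro ⟨b, ⟨hbE, hba⟩, rfl⟩
        rw [Finset.mem_coe, mem_support_iff, coeff_pencil_eq_of_label A f hsupp hdis Λ v hcol φ hbE, hba, hLφ]
        exact hLa
    rw [hsuppeq]
    exact hv

/-- **The kernel implies the class-hull vertex bound on small labelled frames** (Conjecture K of the line notes, restricted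
to small frames, as a NECESSARY condition for `stub_smallShadow`, whose registered signature is the hypothesis verbatim). -/
theorem classVertexWords_le_of_smallShadow
    (hK : ∃ P : ℕ, ∀ (k n : ℕ) (A : Fin n → Finset (Fin 2 →₀ ℕ)) (f : Fin k → Fin n → MvPolynomial (Fin 2) ℂ),
      n ≤ 4 * k ^ 2 → (∀ j, (A j).card ≤ 4 * k ^ 2 + 1) → (QuasiPoly.fshadow A f).ncard ≤ (k + 2) ^ P) :
    ∃ P : ℕ, ∀ (k n : ℕ) (A : Fin n → Finset (Fin 2 →₀ ℕ)) (f : Fin k → Fin n → MvPolynomial (Fin 2) ℂ)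
      (Y : Type) (Λ : (Fin n → (Fin 2 →₀ ℕ)) → Y) (v : Y → Fin k → ℂ),
      n ≤ 4 * k ^ 2 → (∀ j, (A j).card ≤ 4 * k ^ 2 + 1) → (∀ i j, (f i j).support ⊆ A j) →
      (∀ a b : Fin n → (Fin 2 →₀ ℕ), (∀ j, a j ∈ A j) → (∀ j, b j ∈ A j) → ∑ j, a j = ∑ j, b j → a = b) →
      (∀ a ∈ Fintype.piFinset A, QuasiPoly.col f a = v (Λ a)) →
      (∀ a ∈ Fintype.piFinset A, v (Λ a) ∉ Submodule.span ℂ (v '' {y : Y | y ≠ Λ a})) →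
      {a : Fin n → (Fin 2 →₀ ℕ) | a ∈ Fintype.piFinset A ∧
        (fun e : Fin 2 →₀ ℕ => fun i : Fin 2 => ((e i : ℕ) : ℝ)) (∑ j, a j) ∈
          Set.extremePoints ℝ (convexHull ℝ ((fun e : Fin 2 →₀ ℕ => fun i : Fin 2 => ((e i : ℕ) : ℝ)) ''
            ((fun b : Fin n → (Fin 2 →₀ ℕ) => ∑ j, b j) ''
              {b : Fin n → (Fin 2 →₀ ℕ) | b ∈ Fintype.piFinset A ∧ Λ b = Λ a})))}.ncard ≤ (k + 2) ^ P := by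
  obtain ⟨P, hP⟩ := hK
  refine ⟨P, fun k n A f Y Λ v hn hcard hsupp hdis hcol hsep => ?_⟩
  rw [← fshadow_eq_classVertexWords A f hsupp hdis Λ v hcol hsep]
  exact hP k n A f hn hcard

end ShadowVerticesDesign

end Summit.ValiantsHypothesis.ValiantsHypothesis.Theorems.NewtonUnitEquationsDissociatedUniform

namespace Summit.ValiantsHypothesis.ValiantsHypothesis.Theorems.NewtonUnitEquationsDissociatedUniform

/-! ## Non-separated labels: the shadow still lies in the class-hull vertex words

The inclusion `⊆` of `fshadow_eq_classVertexWords` does not use the separation hypothesis `hsep`: whenever the Khatri–Rao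
columns factor through ANY label `Λ` (every pencil member is then a function of the label), a shadow word is a vertex word of
its own label class.  This covers the frames whose tensor span consists of SEPARABLE functions `∑ σ, F σ (g σ a)` of several
independent abelian labelings `g σ` (`k = ∑ σ (|G σ| - 1) + 1` character products; label = the joint label, column table = the
concatenated character tables, which is not separated) and the CNF / semilattice couplings of the disprover's census: for all
of them the frame shadow is contained in the union of the JOINT-class hull vertex words, so a polynomial joint-class count
bounds the kernel on that stratum (`ncard_fshadow_le_mul_of_label`). [folklore]
-/

namespace ShadowVerticesDesign

open QuasiPoly ShadowVertices

variable {k m : ℕ} {Y : Type}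

/-- **Shadow words are class-hull vertex words (no separation needed).**  If the columns of a dissociated frame factor
through a label `Λ` (`col f a = v (Λ a)` on the box, `v` arbitrary), then every word of the frame shadow has its point among
the vertices of the convex hull of the points of its own label class. [folklore] -/
theorem fshadow_subset_classVertexWords (A : Fin m → Finset (Fin 2 →₀ ℕ)) (f : Fin k → Fin m → MvPolynomial (Fin 2) ℂ)
    (hsupp : ∀ i j, (f i j).support ⊆ A j)
    (hdis : ∀ a b : Fin m → (Fin 2 →₀ ℕ), (∀ j, a j ∈ A j) → (∀ j, b j ∈ A j) → ∑ j, a j = ∑ j, b j → a = b)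
    (Λ : (Fin m → (Fin 2 →₀ ℕ)) → Y) (v : Y → Fin k → ℂ)
    (hcol : ∀ a ∈ Fintype.piFinset A, col f a = v (Λ a)) :
    fshadow A f ⊆ {a : Fin m → (Fin 2 →₀ ℕ) | a ∈ Fintype.piFinset A ∧
      (fun e : Fin 2 →₀ ℕ => fun i : Fin 2 => ((e i : ℕ) : ℝ)) (∑ j, a j) ∈
        Set.extremePoints ℝ (convexHull ℝ ((fun e : Fin 2 →₀ ℕ => fun i : Fin 2 => ((e i : ℕ) : ℝ)) ''
          ((fun b : Fin m → (Fin 2 →₀ ℕ) => ∑ j, b j) ''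
            {b : Fin m → (Fin 2 →₀ ℕ) | b ∈ Fintype.piFinset A ∧ Λ b = Λ a})))} := by
  classical
  rw [fshadow_eq_pencilVertexWords A f hsupp hdis]
  rintro a ⟨haE, φ, hv⟩
  refine ⟨haE, ?_⟩
  -- the point of `a` is in the support, so its coefficient is nonzero; the whole class has the same coefficient
  have hmem : (fun e : Fin 2 →₀ ℕ => fun i : Fin 2 => ((e i : ℕ) : ℝ)) (∑ j, a j) ∈
      (fun e : Fin 2 →₀ ℕ => fun i : Fin 2 => ((e i : ℕ) : ℝ)) ''
        ((∑ i, C (φ i) * ∏ j, f i j).support : Set (Fin 2 →₀ ℕ)) := extremePoints_convexHull_subset hv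
  obtain ⟨e, he, hea⟩ := hmem
  have hea' : e = ∑ j, a j := by
    ext i
    have h := congr_fun hea i
    dsimp only at h
    exact_mod_cast h
  subst hea'
  have hne : ∑ i, φ i * v (Λ a) i ≠ 0 := by
    rw [← coeff_pencil_eq_of_label A f hsupp hdis Λ v hcol φ haE]
    exact mem_support_iff.mp (Finset.mem_coe.mp he)
  -- the class lies in the support; extreme points of the larger hull inside the class stay extreme
  have hsub : (fun b : Fin m → (Fin 2 →₀ ℕ) => ∑ j, b j) ''
        {b : Fin m → (Fin 2 →₀ ℕ) | b ∈ Fintype.piFinset A ∧ Λ b = Λ a} ⊆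
      ((∑ i, C (φ i) * ∏ j, f i j).support : Set (Fin 2 →₀ ℕ)) := by
    rintro _ ⟨b, ⟨hbE, hba⟩, rfl⟩
    rw [Finset.mem_coe, mem_support_iff, coeff_pencil_eq_of_label A f hsupp hdis Λ v hcol φ hbE, hba]
    exact hne
  have hST := Set.image_mono (f := fun e : Fin 2 →₀ ℕ => fun i : Fin 2 => ((e i : ℕ) : ℝ)) hsub
  rw [mem_extremePoints] at hv ⊢
  refine ⟨subset_convexHull ℝ _ ⟨∑ j, a j, ⟨a, ⟨haE, rfl⟩, rfl⟩, rfl⟩, fun x₁ hx₁ x₂ hx₂ hx => ?_⟩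
  exact hv.2 x₁ (convexHull_mono hST hx₁) x₂ (convexHull_mono hST hx₂) hx

/-- **Counting form.**  If the columns factor through a label `Λ`, at most `N` labels are realised on the box, and every
realised label class has at most `V` words whose point is a vertex of the class hull, then `|fshadow A f| ≤ N · V`.
(For sums of `s` independent abelian designs the label is the joint label and `N` the number of joint classes.) [folklore] -/
theorem ncard_fshadow_le_mul_of_label (A : Fin m → Finset (Fin 2 →₀ ℕ)) (f : Fin k → Fin m → MvPolynomial (Fin 2) ℂ)
    (hsupp : ∀ i j, (f i j).support ⊆ A j)
    (hdis : ∀ a b : Fin m → (Fin 2 →₀ ℕ), (∀ j, a j ∈ A j) → (∀ j, b j ∈ A j) → ∑ j, a j = ∑ j, b j → a = b)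
    (Λ : (Fin m → (Fin 2 →₀ ℕ)) → Y) (v : Y → Fin k → ℂ)
    (hcol : ∀ a ∈ Fintype.piFinset A, col f a = v (Λ a)) (N V : ℕ)
    (hN : (Λ '' (Fintype.piFinset A : Set (Fin m → (Fin 2 →₀ ℕ)))).ncard ≤ N)
    (hV : ∀ y : Y, {a : Fin m → (Fin 2 →₀ ℕ) | a ∈ Fintype.piFinset A ∧ Λ a = y ∧
      (fun e : Fin 2 →₀ ℕ => fun i : Fin 2 => ((e i : ℕ) : ℝ)) (∑ j, a j) ∈
        Set.extremePoints ℝ (convexHull ℝ ((fun e : Fin 2 →₀ ℕ => fun i : Fin 2 => ((e i : ℕ) : ℝ)) ''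
          ((fun b : Fin m → (Fin 2 →₀ ℕ) => ∑ j, b j) ''
            {b : Fin m → (Fin 2 →₀ ℕ) | b ∈ Fintype.piFinset A ∧ Λ b = y})))}.ncard ≤ V) :
    (fshadow A f).ncard ≤ N * V := by
  classical
  have hfin : (fshadow A f).Finite := cshadow_finite _ _ _ _
  set s : Finset (Fin m → (Fin 2 →₀ ℕ)) := hfin.toFinset with hs
  set t : Finset Y := (Fintype.piFinset A).image Λ with ht
  have hsub := fshadow_subset_classVertexWords A f hsupp hdis Λ v hcol
  -- every shadow word maps into the realised labels
  have hmaps : ∀ a ∈ s, Λ a ∈ t := by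
    intro a ha
    rw [hs, Set.Finite.mem_toFinset] at ha
    exact Finset.mem_image_of_mem Λ (hsub ha).1
  -- each fibre of `Λ` meets the shadow in at most `V` words
  have hfib : ∀ y ∈ t, (s.filter fun a => Λ a = y).card ≤ V := by
    intro y _
    rw [← Set.ncard_coe_finset]
    refine le_trans (Set.ncard_le_ncard ?_ (Set.toFinite _)) (hV y)
    intro a ha
    rw [Finset.mem_coe, Finset.mem_filter, hs, Set.Finite.mem_toFinset] at ha
    obtain ⟨ha, hay⟩ := ha
    obtain ⟨haE, hv⟩ := hsub ha
    subst hay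
    exact ⟨haE, rfl, hv⟩
  have hcard := Finset.card_le_mul_card_image_of_maps_to hmaps V hfib
  have hs' : (fshadow A f).ncard = s.card := by
    rw [hs, ← Set.ncard_coe_finset, Set.Finite.coe_toFinset]
  have ht' : t.card = (Λ '' (Fintype.piFinset A : Set (Fin m → (Fin 2 →₀ ℕ)))).ncard := by
    rw [ht, ← Set.ncard_coe_finset, Finset.coe_image]
  rw [hs']
  calc s.card ≤ V * t.card := hcard
    _ ≤ V * N := Nat.mul_le_mul_left _ (ht' ▸ hN)
    _ = N * V := Nat.mul_comm _ _

end ShadowVerticesDesign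

end Summit.ValiantsHypothesis.ValiantsHypothesis.Theorems.NewtonUnitEquationsDissociatedUniform
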